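import Mathlib
import HarnessLib
import Summits.HubbardSuperconductivity.HubbardSuperconductivity.Theorems.KLProgrammeKLRegimeVolumeLimitFrameCovariance
import Summits.HubbardSuperconductivity.HubbardSuperconductivity.Theorems.KLProgrammeKLRegimeTwoPointAssemblyStubAsmPartition
import Summits.HubbardSuperconductivity.HubbardSuperconductivity.Theorems.KLProgrammeKLRegimeSplitGenericV4

/-!
# Child 5 `KLRegimeVolumeLimitV11` (stmt-HubbardSuperconductivity-19826) — the volume-limit text is owed in ONE frame, unconditionally:
# `FinalTwoLegVolLimit β U μ K' Mstar → FinalTwoLegVolLimit β U μ K Mstar` for ANY two frames and every `β > 0` (seat hubbard-kl-k3c5-p2, g2)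

The frame transfer of `…VolumeLimitFrameCovariance` (`finalTwoLegVolLimit_frame_transfer`, p460368) carried the hypothesis that the bare
normalised partition function `D_{L,M}(U) = ∫dμ_C e^{−V(U)}` is non-zero at every volume beyond the thresholds `(LD, Mstar)`.  This file
removes it:

* §1 JUNK VALUE.  `effAction C V = 0` whenever `Z = ∫dμ_C e^{−V}` is not a unit (`Ring.inverse Z = 0`, `log (0 − 1 + 1)`-series empty):
  `effAction_eq_zero_of_not_isUnit` (generic Grassmann lemma).  For the carrier of the VL text: `D_{L,M}(U) = 0 ⇒
  klSelfEnergy L M β U μ K klE0 (nScales β + 1) k σ = 0` in EVERY frame (`klSelfEnergy_nScales_succ_eq_zero_of_partitionFn_eq_zero`; the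
  countertermed partition function is `Z_K · D`, `effPartitionFn_CT_eq_mul_bare`).  So clause (i) of `FinalTwoLegVolLimit` (the uniform
  bound `∀ M ≥ Mstar L`) never bites at a volume where `D` vanishes: the junk value is `0`.
* §2 UNCONDITIONAL TRANSFER.  Clause (i): at `D ≠ 0` the frame covariance `Σ̂^K = (ĝ_{K'}/ĝ_K)² Σ̂^{K'} + (K − K')(p) ĝ_{K'}/ĝ_K` and the
  dressing bound `1 + (‖K‖₀ + ‖K'‖₀)β/π`; at `D = 0` both sides vanish.  Clause (ii): eventually in `M` at every `L ≥ 3` the bare partition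
  function is non-zero for EVERY real `U` (t2's `stub_asm_partition`, p451738), so the covariance applies beyond `max M₁ M_D(L)`.
  Result: `finalTwoLegVolLimit_frame_transfer'` (no `hD`), `finalTwoLegVolLimit_iff_frame`, monotonicity in the thresholds
  `finalTwoLegVolLimit_mono`.
* §3 CONSEQUENCE FOR THE CHILD.  `VolumeLimitP2 Pr FinalTwoLegVolLimit W` follows from its ONE-FRAME version: it suffices that the tower
  of the admissible frame `K` imply the VL text of ANY FIXED frame `K₀` of the prover's choice (e.g. the bare frame, whose carrier is the bare
  momentum-space two-point ratio `N/D` re-amputated by `1/(−iω + ε − μ)`, `selfEnergy_fullActionCT_eq_bare_ratio`):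
  `volumeLimitP2_of_oneFrame`.  Everything is proved; no definition.
-/

noncomputable section

namespace Summit.HubbardSuperconductivity.HubbardSuperconductivity.Theorems.TwoPointAssembly

set_option linter.dupNamespace false -- summit = problem name (single-conjunct summit), D-0017

open Finset Filter Topology Literature.MathematicalPhysics.QuantumLattice Literature.Probability.LatticeModels GrassmannAlgebra
open Summit.HubbardSuperconductivity.HubbardSuperconductivity.Theorems.KLRegimeSplit
open Summit.HubbardSuperconductivity.HubbardSuperconductivity.Theorems.KLProgrammeLegKernels

/-! ## §1 The junk value of the effective action is `0` -/

/-- **`Z` not a unit ⇒ `effAction C V = 0`** (`Ring.inverse Z = 0`, and `log(1 + (−1))` is the empty sum since `−1` is not nilpotent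
in a nontrivial algebra; in a trivial one everything is `0`). -/
theorem effAction_eq_zero_of_not_isUnit {R : Type*} [CommRing R] [Algebra ℚ R] {Γ : Type*} [Fintype Γ]
    (C : Matrix Γ Γ R) (V : GrassmannAlgebra R Γ) (h : ¬ IsUnit (effPartitionFn R C V)) : effAction R C V = 0 := by
  rw [effAction_def, Ring.inverse_non_unit _ h, zero_smul, zero_sub, neg_eq_zero]
  by_cases hs : Subsingleton (GrassmannAlgebra R Γ)
  · exact Subsingleton.elim _ _
  · haveI : Nontrivial (GrassmannAlgebra R Γ) := not_subsingleton_iff_nontrivial.mp hs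
    have hn : ¬ IsNilpotent (-1 : GrassmannAlgebra R Γ) := fun hnil => by
      obtain ⟨k, hk⟩ := hnil
      rw [neg_one_pow_eq_pow_mod_two] at hk
      rcases Nat.mod_two_eq_zero_or_one k with h0 | h1
      · rw [h0, pow_zero] at hk; exact one_ne_zero hk
      · rw [h1, pow_one, neg_eq_zero] at hk; exact one_ne_zero hk
    rw [grassmannLog1p, nilpotencyClass, Nat.sInf_eq_zero.2 (Or.inr ?_), Finset.range_zero, Finset.sum_empty]
    ext k
    exact ⟨fun hk => hn ⟨k, hk⟩, fun h => h.elim⟩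

variable {L M : ℕ} [NeZero L]

/-- **`D_{L,M}(U) = 0 ⇒ 𝒢^K = 0`**: the fully integrated countertermed action vanishes (junk) in EVERY frame when the bare normalised
partition function does (`Z^K_CT = Z_K · D`). -/
theorem fullActionCT_eq_zero_of_partitionFn_eq_zero {β : ℝ} (hβ : β ≠ 0) (U μ : ℝ) (K : TrigPolyC4v)
    (hD : effPartitionFn ℂ (hubbardCovariance L M β μ 0) (hubbardInteraction L M β U) = 0) :
    fullActionCT L M β U μ K = 0 := by
  rw [fullActionCT]
  refine effAction_eq_zero_of_not_isUnit _ _ ?_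
  rw [effPartitionFn_CT_eq_mul_bare hβ U μ K, hD, mul_zero]
  exact not_isUnit_zero

/-- **The VL carrier's junk value is `0`**: for `β > 0` and `D_{L,M}(U) = 0`, `klSelfEnergy L M β U μ K klE0 (nScales β + 1) k σ = 0`. -/
theorem klSelfEnergy_nScales_succ_eq_zero_of_partitionFn_eq_zero {β : ℝ} (hβ : 0 < β) (U μ : ℝ) (K : TrigPolyC4v)
    (hD : effPartitionFn ℂ (hubbardCovariance L M β μ 0) (hubbardInteraction L M β U) = 0) (k : FreqMomentum L M) (σ : Fin 2) :
    klSelfEnergy L M β U μ K klE0 (nScales β + 1) k σ = 0 := by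
  rw [klSelfEnergy, klEffectiveAction_nScales_succ L M hβ, ← fullActionCT, fullActionCT_eq_zero_of_partitionFn_eq_zero hβ.ne' U μ K hD,
    selfEnergy_zero]

/-- **Frame covariance of the carrier, `D`-free form**: for `β > 0`, EITHER `D_{L,M}(U) = 0` and the carrier vanishes in both frames, OR the
covariance `Σ̂^K = (ĝ_{K'}/ĝ_K)² Σ̂^{K'} + (K − K')(p) ĝ_{K'}/ĝ_K` holds. -/
theorem klSelfEnergy_nScales_succ_frame_covariance_or {β : ℝ} (hβ : 0 < β) (U μ : ℝ) (K K' : TrigPolyC4v) (k : FreqMomentum L M)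
    (σ : Fin 2) :
    (klSelfEnergy L M β U μ K klE0 (nScales β + 1) k σ = 0 ∧ klSelfEnergy L M β U μ K' klE0 (nScales β + 1) k σ = 0) ∨
      klSelfEnergy L M β U μ K klE0 (nScales β + 1) k σ =
        (propCT L M β μ K' k / propCT L M β μ K k) ^ 2 * klSelfEnergy L M β U μ K' klE0 (nScales β + 1) k σ +
          ((K.eval (latticeMomentum L k.2) - K'.eval (latticeMomentum L k.2) : ℝ) : ℂ) *
            (propCT L M β μ K' k / propCT L M β μ K k) := by
  by_cases hD : effPartitionFn ℂ (hubbardCovariance L M β μ 0) (hubbardInteraction L M β U) = 0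
  · exact Or.inl ⟨klSelfEnergy_nScales_succ_eq_zero_of_partitionFn_eq_zero hβ U μ K hD k σ,
      klSelfEnergy_nScales_succ_eq_zero_of_partitionFn_eq_zero hβ U μ K' hD k σ⟩
  · refine Or.inr ?_
    rw [klSelfEnergy, klSelfEnergy, klEffectiveAction_nScales_succ L M hβ, klEffectiveAction_nScales_succ L M hβ, ← fullActionCT,
      ← fullActionCT]
    exact selfEnergy_fullActionCT_frame_covariance hβ.ne' U μ K K' k σ hD

/-! ## §2 The unconditional frame transfer -/

omit [NeZero L] in
/-- t2's `stub_asm_partition` in threshold form: at every `L ≥ 3`, `β > 0`, the bare normalised partition function is non-zero from some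
`M` on, for EVERY real `U`. -/
theorem exists_partitionFn_ne_zero_threshold (L : ℕ) [NeZero L] (hL : 3 ≤ L) {β : ℝ} (hβ : 0 < β) (μ U : ℝ) :
    ∃ MD : ℕ, ∀ M : ℕ, MD ≤ M → effPartitionFn ℂ (hubbardCovariance L M β μ 0) (hubbardInteraction L M β U) ≠ 0 :=
  Filter.eventually_atTop.mp (stub_asm_partition L hL β hβ μ U)

/-- **Monotonicity in the thresholds**: larger Matsubara thresholds weaken clause (i) and leave clause (ii) untouched. -/
theorem finalTwoLegVolLimit_mono {β U μ : ℝ} {K : TrigPolyC4v} {Mstar Mstar' : ℕ → ℕ} (hle : ∀ L, Mstar L ≤ Mstar' L)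
    (h : FinalTwoLegVolLimit β U μ K Mstar) : FinalTwoLegVolLimit β U μ K Mstar' := by
  obtain ⟨sig, B, L₀, hcont, hbound, hlim⟩ := h
  exact ⟨sig, B, L₀, hcont, fun L _ hL M _ hM k σ => hbound L hL M ((hle L).trans hM) k σ, hlim⟩

/-- **FRAME TRANSFER OF THE VL TEXT, UNCONDITIONAL.**  For `β > 0` and ANY two frames `K`, `K'`:
`FinalTwoLegVolLimit β U μ K' Mstar → FinalTwoLegVolLimit β U μ K Mstar`.  (Clause (i): frame covariance where `D_{L,M}(U) ≠ 0`, junk value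
`0` where it vanishes; clause (ii): `D_{L,M}(U) ≠ 0` eventually in `M` at every `L ≥ 3`, `exists_partitionFn_ne_zero_threshold`.) -/
theorem finalTwoLegVolLimit_frame_transfer' {β : ℝ} (hβ : 0 < β) (U μ : ℝ) (K K' : TrigPolyC4v) (Mstar : ℕ → ℕ)
    (h : FinalTwoLegVolLimit β U μ K' Mstar) : FinalTwoLegVolLimit β U μ K Mstar := by
  obtain ⟨sig', B', L₀', hcont', hbound', hlim'⟩ := h
  set ωn : ℤ → ℝ := fun n => Real.pi * (2 * (n : ℝ) + 1) / β with hωn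
  -- the dressing `(−iω_n + e_K(p))/(−iω_n + e_{K'}(p))` and the frame difference `(K − K')(p)` as functions of `(n, p)`
  set eK : TrigPolyC4v → (Fin 2 → ℝ) → ℝ := fun J p => -2 * ∑ i, Real.cos (p i) - μ - J.eval p with heK
  set dress : ℤ → (Fin 2 → ℝ) → ℂ := fun n p =>
    (-Complex.I * (ωn n : ℂ) + (eK K p : ℂ)) / (-Complex.I * (ωn n : ℂ) + (eK K' p : ℂ)) with hdress
  set δK : (Fin 2 → ℝ) → ℝ := fun p => K.eval p - K'.eval p with hδK
  set Bd : ℝ := 1 + (K.coeffNorm 0 + K'.coeffNorm 0) * (β / Real.pi) with hBd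
  have hK0 : 0 ≤ K.coeffNorm 0 := TrigPolyC4v.coeffNorm_nonneg 0 K
  have hK0' : 0 ≤ K'.coeffNorm 0 := TrigPolyC4v.coeffNorm_nonneg 0 K'
  have hBd1 : 1 ≤ Bd := le_add_of_nonneg_right (by positivity)
  have hBd0 : 0 ≤ Bd := le_trans zero_le_one hBd1
  have hωn_abs : ∀ n : ℤ, Real.pi / β ≤ |ωn n| := fun n => by
    rw [hωn]; dsimp only
    rw [abs_div, abs_of_pos hβ, abs_mul, abs_of_pos Real.pi_pos]
    exact div_le_div_of_nonneg_right (le_mul_of_one_le_right Real.pi_pos.le (one_le_abs_two_mul_add_one n)) hβ.le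
  have hδ_le : ∀ p : Fin 2 → ℝ, |δK p| ≤ K.coeffNorm 0 + K'.coeffNorm 0 := fun p => by
    rw [hδK]; dsimp only
    calc |K.eval p - K'.eval p| ≤ |K.eval p| + |K'.eval p| := abs_sub _ _
      _ ≤ K.coeffNorm 0 + K'.coeffNorm 0 := add_le_add (TrigPolyC4v.abs_eval_le_coeffNorm K p) (TrigPolyC4v.abs_eval_le_coeffNorm K' p)
  have heKdiff : ∀ p : Fin 2 → ℝ, eK K p - eK K' p = -(δK p) := fun p => by rw [heK, hδK]; dsimp only; ring
  -- bound of the dressing, anywhere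
  have hdress_le : ∀ (ω : ℝ), Real.pi / β ≤ |ω| → ∀ p : Fin 2 → ℝ,
      ‖(-Complex.I * (ω : ℂ) + (eK K p : ℂ)) / (-Complex.I * (ω : ℂ) + (eK K' p : ℂ))‖ ≤ Bd := by
    intro ω hω p
    refine (norm_shift_ratio_le hβ ω hω _ _).trans ?_
    rw [heKdiff, abs_neg, hBd]
    gcongr
    exact hδ_le p
  -- the band on the grid
  have heK_grid : ∀ (J : TrigPolyC4v) (L : ℕ) [NeZero L] (q : TorusSite 2 L), (nambuXiCT L μ J q : ℝ) = eK J (latticeMomentum L q) := by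
    intro J L _ q; rw [heK]; dsimp only; rw [nambuXiCT, torusBand]
  refine ⟨fun n p σ => dress n p ^ 2 * sig' n p σ + (δK p : ℂ) * dress n p,
    Bd ^ 2 * max B' 0 + (K.coeffNorm 0 + K'.coeffNorm 0) * Bd, max L₀' 3, ?_, ?_, ?_⟩
  · -- continuity
    intro n σ
    have hden : ∀ p : Fin 2 → ℝ, -Complex.I * (ωn n : ℂ) + (eK K' p : ℂ) ≠ 0 := by
      intro p hp
      have := congrArg Complex.im hp
      simp at this
      have h' := hωn_abs n
      have hπβ : 0 < Real.pi / β := div_pos Real.pi_pos hβ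
      rw [this, abs_zero] at h'
      linarith
    have heKc : ∀ J : TrigPolyC4v, Continuous (eK J) := fun J => by
      rw [heK]
      exact ((continuous_const.mul (continuous_finsetSum _ fun i _ =>
        Real.continuous_cos.comp (continuous_apply i))).sub continuous_const).sub (TrigPolyC4v.continuous_eval J)
    have hd : Continuous (dress n) := by
      refine Continuous.div ?_ ?_ hden
      · exact continuous_const.add (Complex.continuous_ofReal.comp (heKc K))
      · exact continuous_const.add (Complex.continuous_ofReal.comp (heKc K'))
    have hδc : Continuous fun p => (δK p : ℂ) :=
      Complex.continuous_ofReal.comp ((TrigPolyC4v.continuous_eval K).sub (TrigPolyC4v.continuous_eval K'))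
    exact ((hd.pow 2).mul (hcont' n σ)).add (hδc.mul hd)
  · -- uniform bound: covariance where `D ≠ 0`, junk `0` where `D = 0`
    intro L _ hL M _ hM k σ
    have hL0 : L₀' ≤ L := le_trans (le_max_left _ _) hL
    have hbd_nonneg : 0 ≤ Bd ^ 2 * max B' 0 + (K.coeffNorm 0 + K'.coeffNorm 0) * Bd := by positivity
    rcases klSelfEnergy_nScales_succ_frame_covariance_or hβ U μ K K' k σ with ⟨hzero, -⟩ | hcov
    · rw [hzero, norm_zero]; exact hbd_nonneg
    have hdr : ‖propCT L M β μ K' k / propCT L M β μ K k‖ ≤ Bd := by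
      rw [propCT_div_propCT_eq hβ.ne', heK_grid K L k.2, heK_grid K' L k.2]
      exact hdress_le _ (pi_div_le_abs_matsubaraFreq hβ k.1) _
    have hS' : ‖klSelfEnergy L M β U μ K' klE0 (nScales β + 1) k σ‖ ≤ max B' 0 := (hbound' L hL0 M hM k σ).trans (le_max_left _ _)
    rw [hcov]
    calc ‖(propCT L M β μ K' k / propCT L M β μ K k) ^ 2 * klSelfEnergy L M β U μ K' klE0 (nScales β + 1) k σ +
            ((K.eval (latticeMomentum L k.2) - K'.eval (latticeMomentum L k.2) : ℝ) : ℂ) *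
              (propCT L M β μ K' k / propCT L M β μ K k)‖
        ≤ ‖propCT L M β μ K' k / propCT L M β μ K k‖ ^ 2 * ‖klSelfEnergy L M β U μ K' klE0 (nScales β + 1) k σ‖ +
            |K.eval (latticeMomentum L k.2) - K'.eval (latticeMomentum L k.2)| * ‖propCT L M β μ K' k / propCT L M β μ K k‖ := by
          refine (norm_add_le _ _).trans (le_of_eq ?_)
          rw [norm_mul, norm_pow, norm_mul, Complex.norm_real, Real.norm_eq_abs]
      _ ≤ Bd ^ 2 * max B' 0 + (K.coeffNorm 0 + K'.coeffNorm 0) * Bd := by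
          gcongr
          exact hδ_le _
  · -- grid convergence: beyond `max M₁' M_D(L)` the bare partition function is non-zero (t2) and the covariance applies
    intro n σ ε hε
    have hε' : 0 < ε / Bd ^ 2 := by positivity
    obtain ⟨L₁', hL₁'⟩ := hlim' n σ (ε / Bd ^ 2) hε'
    refine ⟨max L₁' 3, fun L _ hLge => ?_⟩
    have hL1 : L₁' ≤ L := le_trans (le_max_left _ _) hLge
    have hL3 : 3 ≤ L := le_trans (le_max_right _ _) hLge
    obtain ⟨M₁', hM₁'⟩ := hL₁' L hL1
    obtain ⟨MD, hMD⟩ := exists_partitionFn_ne_zero_threshold L hL3 hβ μ U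
    refine ⟨max M₁' MD, fun M _ hMge ω hω q => ?_⟩
    have hM1 : M₁' ≤ M := le_trans (le_max_left _ _) hMge
    have hDne := hMD M (le_trans (le_max_right _ _) hMge)
    have hcov : klSelfEnergy L M β U μ K klE0 (nScales β + 1) (ω, q) σ =
        (propCT L M β μ K' (ω, q) / propCT L M β μ K (ω, q)) ^ 2 * klSelfEnergy L M β U μ K' klE0 (nScales β + 1) (ω, q) σ +
          ((K.eval (latticeMomentum L q) - K'.eval (latticeMomentum L q) : ℝ) : ℂ) *
            (propCT L M β μ K' (ω, q) / propCT L M β μ K (ω, q)) := by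
      rw [klSelfEnergy, klSelfEnergy, klEffectiveAction_nScales_succ L M hβ, klEffectiveAction_nScales_succ L M hβ, ← fullActionCT,
        ← fullActionCT]
      exact selfEnergy_fullActionCT_frame_covariance hβ.ne' U μ K K' (ω, q) σ hDne
    -- on the grid the dressing IS `dress n (p_q)` and the frame difference IS `δK (p_q)`
    have hdr : propCT L M β μ K' (ω, q) / propCT L M β μ K (ω, q) = dress n (latticeMomentum L q) := by
      rw [propCT_div_propCT_eq hβ.ne', hdress]
      dsimp only
      rw [heK_grid K L q, heK_grid K' L q, matsubaraFreq_of_matsubaraInt_eq β hω]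
    have hdb : ‖dress n (latticeMomentum L q)‖ ≤ Bd := by
      rw [hdress]
      exact hdress_le _ (hωn_abs n) _
    have hgrid := hM₁' M hM1 ω hω q
    rw [hcov, hdr]
    calc ‖dress n (latticeMomentum L q) ^ 2 * klSelfEnergy L M β U μ K' klE0 (nScales β + 1) (ω, q) σ +
            ((K.eval (latticeMomentum L q) - K'.eval (latticeMomentum L q) : ℝ) : ℂ) * dress n (latticeMomentum L q) -
          (dress n (latticeMomentum L q) ^ 2 * sig' n (latticeMomentum L q) σ +
            (δK (latticeMomentum L q) : ℂ) * dress n (latticeMomentum L q))‖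
        = ‖dress n (latticeMomentum L q)‖ ^ 2 *
            ‖klSelfEnergy L M β U μ K' klE0 (nScales β + 1) (ω, q) σ - sig' n (latticeMomentum L q) σ‖ := by
          rw [hδK]
          dsimp only
          rw [show ∀ a s t d : ℂ, a ^ 2 * s + d * a - (a ^ 2 * t + d * a) = a ^ 2 * (s - t) from fun a s t d => by ring,
            norm_mul, norm_pow]
      _ ≤ Bd ^ 2 * (ε / Bd ^ 2) := by gcongr
      _ = ε := by field_simp

/-- **The VL text is frame-INDEPENDENT** (`β > 0`): `FinalTwoLegVolLimit β U μ K Mstar ↔ FinalTwoLegVolLimit β U μ K' Mstar`. -/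
theorem finalTwoLegVolLimit_iff_frame {β : ℝ} (hβ : 0 < β) (U μ : ℝ) (K K' : TrigPolyC4v) (Mstar : ℕ → ℕ) :
    FinalTwoLegVolLimit β U μ K Mstar ↔ FinalTwoLegVolLimit β U μ K' Mstar :=
  ⟨finalTwoLegVolLimit_frame_transfer' hβ U μ K' K Mstar, finalTwoLegVolLimit_frame_transfer' hβ U μ K K' Mstar⟩

/-! ## §3 Consequence for child 5: the volume-limit child is owed in one frame of the prover's choice -/

/-- **`VolumeLimitP2 Pr FinalTwoLegVolLimit W` from its ONE-FRAME version.**  If, for all constants, some `c₅ > 0`, all `c ≤ c₅`, some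
`U₀ > 0`, at every regime point and for every admissible frame `K` carrying the full tower beyond `(Lstar, Mstar)`, the VL text holds in a
FIXED frame `K₀` (the same for all `K`; e.g. the bare frame), then the child holds as typed (frame transfer `K₀ → K`, `β ≥ klBetaMin > 0`). -/
theorem volumeLimitP2_of_oneFrame {Pr : Preds} {W : Set ℝ} (K₀ : TrigPolyC4v)
    (h : ∀ G : GeoConsts, ∀ P : SplitConsts, ∀ Q : EngConsts, ∀ R : RenConsts, G.WF → P.WF → Q.WF → R.WF →
      ∃ c₅ : ℝ, 0 < c₅ ∧ ∀ c : ℝ, 0 < c → c ≤ c₅ → ∃ U₀ : ℝ, 0 < U₀ ∧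
        ∀ μ ∈ W, ∀ U : ℝ, 0 < U → U ≤ U₀ → ∀ β : ℝ, klBetaMin ≤ β → β ≤ Real.exp (c / U ^ 2) →
          ∀ K : TrigPolyC4v, Pr.frameOK R U (nScales β) μ K →
            ∀ (Lstar : ℕ) (Mstar : ℕ → ℕ), TowerP Pr G P Q R β U μ K Lstar Mstar → FinalTwoLegVolLimit β U μ K₀ Mstar) :
    VolumeLimitP2 Pr FinalTwoLegVolLimit W := by
  intro G P Q R hG hP hQ hR
  obtain ⟨c₅, hc₅, hc⟩ := h G P Q R hG hP hQ hR
  refine ⟨c₅, hc₅, fun c hc0 hcle => ?_⟩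
  obtain ⟨U₀, hU₀, hmain⟩ := hc c hc0 hcle
  refine ⟨U₀, hU₀, fun μ hμ U hU hUle β hβ hβle K hK Lstar Mstar hT => ?_⟩
  have hβpos : 0 < β := lt_of_lt_of_le (by norm_num [klBetaMin]) hβ
  exact finalTwoLegVolLimit_frame_transfer' hβpos U μ K K₀ Mstar (hmain μ hμ U hU hUle β hβ hβle K hK Lstar Mstar hT)

end Summit.HubbardSuperconductivity.HubbardSuperconductivity.Theorems.TwoPointAssembly

end
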